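import Literature.AlgebraicGeometry.Frobenioids.GroupLikeStandardExample
import Literature.AlgebraicGeometry.Frobenioids.PreFrobenioidMorphisms
import Literature.AlgebraicGeometry.Frobenioids.ModelFrobenioidPreFrobenioid
import Mathlib.Data.ZMod.Basic
import HarnessLib

/-!
# A two-level Frobenioid over `B(ℤ/2)` (test object for [FrdI] Prop. 1.6 (v)/(vi))

Mochizuki, *The geometry of Frobenioids I: the general theory*, Kyushu J. Math. **62** (2008)
293–400, §1, Definition 1.3 p. 24 and Proposition 1.6 (v)/(vi) p. 28 [cite: MochizukiFrdI2008, Prop. 1.6 p.28]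
("(v) A object of `C′` is … metrically trivial; base-trivial … if and only if it projects to such an
object of `C`. (vi) A object of `C′` is Aut-ample (respectively, Aut^sub-ample; End-ample) if it
projects to such an object of `C`." — proof: "one checks immediately").

OURS (abc-iut cell, finding F-t8g2-1; not a construction of the paper): the category `C` with two
objects `low`, `top` over the one-object base `D = B(ℤ/2)` (`Aut = {1, σ}`), divisor monoid the
constant `Φ ≡ ℤ_{≥0}` with trivial action, and Hom-sets cut out of `End_{F_Φ}(∗) = {(g, z, n)}`:
`End(low) = {(g, z, 1) : z ≡ ε(g) mod 2}` (`ε(1) = 0`, `ε(σ) = 1`), `Hom(low, top) = End(top) =` all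
triples, `Hom(top, low) = ∅`.  This file: the category, the functor `C → F_Φ`, and the elementary
classification facts (no arrow `top → low`; automorphisms of `low` are trivial; `low → top` is never
invertible; isomorphisms of `top`).  That `C → F_Φ` is a Frobenioid, that `low` is metrically trivial
but not `Aut`-ample, and the resulting fiber-product witness against the printed 'if' of Prop. 1.6 (v)
(«metrically trivial») are in the sequel files.  Nothing here bears on [IUTchIII].
-/

namespace Literature.AlgebraicGeometry.Frobenioids

open CategoryTheory Opposite

namespace TwoLevel

/-- The base monoid: `ℤ/2` written multiplicatively (`D := B(ℤ/2)`). [cite: MochizukiFrdI2008, Prop. 1.6 p.28] -/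
abbrev X : Type := Multiplicative (ZMod 2)

/-- The divisor monoid `(ℤ_{≥0}, +)` written multiplicatively. [cite: MochizukiFrdI2008, Def. 1.1(iii) p.20] -/
abbrev M : Type := Multiplicative ℕ

/-- The base category `D = B(ℤ/2)`: one object, automorphism group `ℤ/2`. [cite: MochizukiFrdI2008, Prop. 1.6 p.28] -/
abbrev D : Type := SingleObj X

/-- The divisor monoid on `D`: constant `ℤ_{≥0}`, trivial action. [cite: MochizukiFrdI2008, Def. 1.1(ii) p.19] -/
abbrev Φ : Dᵒᵖ ⥤ CommMonCat.{0} := trivialMonoidOn X M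

/-- The unique object of `F_Φ`. [cite: MochizukiFrdI2008, Def. 1.1(iii) p.20] -/
abbrev E : ElemFrobenioid Φ := trivObj X M

/-! ### Triples `(g, z, n)` of `End_{F_Φ}(∗)` -/

/-- The base component `g ∈ ℤ/2` of a triple. [cite: MochizukiFrdI2008, Def. 1.1(iii) p.20] -/
def bs (φ : E ⟶ E) : X := ElemFrobenioid.Base φ

/-- The divisor component `z ∈ ℤ_{≥0}` of a triple. [cite: MochizukiFrdI2008, Def. 1.1(iii) p.20] -/
def dv (φ : E ⟶ E) : M := ElemFrobenioid.Div φ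

/-- The Frobenius degree `n` of a triple. [cite: MochizukiFrdI2008, Def. 1.1(iii) p.20] -/
def dg (φ : E ⟶ E) : ℕ+ := ElemFrobenioid.degFr φ

/-- The triple `(g, z, n)` as an endomorphism of `∗` in `F_Φ`. [cite: MochizukiFrdI2008, Def. 1.1(iii) p.20] -/
def tr (g : X) (z : M) (n : ℕ+) : E ⟶ E := ElemFrobenioid.homMk g z n

/-- Base of a triple. [cite: MochizukiFrdI2008, Def. 1.1(iii) p.20] -/
@[simp] theorem bs_tr (g : X) (z : M) (n : ℕ+) : bs (tr g z n) = g := rfl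
/-- Divisor of a triple. [cite: MochizukiFrdI2008, Def. 1.1(iii) p.20] -/
@[simp] theorem dv_tr (g : X) (z : M) (n : ℕ+) : dv (tr g z n) = z := rfl
/-- Degree of a triple. [cite: MochizukiFrdI2008, Def. 1.1(iii) p.20] -/
@[simp] theorem dg_tr (g : X) (z : M) (n : ℕ+) : dg (tr g z n) = n := rfl

/-- A triple is determined by its components. [cite: MochizukiFrdI2008, Def. 1.1(iii) p.20] -/
theorem tr_eq (φ : E ⟶ E) : tr (bs φ) (dv φ) (dg φ) = φ := rfl

/-- Extensionality for triples. [cite: MochizukiFrdI2008, Def. 1.1(iii) p.20] -/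
theorem E_ext {φ ψ : E ⟶ E} (h₁ : bs φ = bs ψ) (h₂ : dv φ = dv ψ) (h₃ : dg φ = dg ψ) : φ = ψ :=
  ElemFrobenioid.Hom.ext h₁ h₂ h₃

/-- Composition of triples: bases multiply (in `ℤ/2`). [cite: MochizukiFrdI2008, Def. 1.1(iii) p.20] -/
@[simp] theorem bs_comp (φ ψ : E ⟶ E) : bs (φ ≫ ψ) = bs ψ * bs φ := rfl

/-- Composition of triples: `Div(φ ≫ ψ) = Div ψ + deg ψ · Div φ` (trivial action). [cite: MochizukiFrdI2008, Def. 1.1(iii) p.20] -/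
@[simp] theorem dv_comp (φ ψ : E ⟶ E) : dv (φ ≫ ψ) = dv ψ * dv φ ^ (dg ψ : ℕ) := rfl

/-- Composition of triples: degrees multiply. [cite: MochizukiFrdI2008, Def. 1.1(iii) p.20] -/
@[simp] theorem dg_comp (φ ψ : E ⟶ E) : dg (φ ≫ ψ) = dg φ * dg ψ := rfl

/-- Base of the identity. [cite: MochizukiFrdI2008, Def. 1.1(iii) p.20] -/
@[simp] theorem bs_id : bs (𝟙 E) = 1 := rfl
/-- Divisor of the identity. [cite: MochizukiFrdI2008, Def. 1.1(iii) p.20] -/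
@[simp] theorem dv_id : dv (𝟙 E) = 1 := rfl
/-- Degree of the identity. [cite: MochizukiFrdI2008, Def. 1.1(iii) p.20] -/
@[simp] theorem dg_id : dg (𝟙 E) = 1 := rfl

/-- `tr 1 0 1` is the identity. [cite: MochizukiFrdI2008, Def. 1.1(iii) p.20] -/
theorem tr_one : tr 1 1 1 = 𝟙 E := rfl

/-- The parity `z mod 2` of a divisor `z ∈ ℤ_{≥0}`. [cite: MochizukiFrdI2008, Prop. 1.6 p.28] -/
def par (z : M) : ZMod 2 := ((Multiplicative.toAdd z : ℕ) : ZMod 2)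

/-- `par` is additive. [cite: MochizukiFrdI2008, Prop. 1.6 p.28] -/
@[simp] theorem par_mul (z w : M) : par (z * w) = par z + par w := by
  simp [par, toAdd_mul, Nat.cast_add]

/-- `par 0 = 0`. [cite: MochizukiFrdI2008, Prop. 1.6 p.28] -/
@[simp] theorem par_one : par 1 = 0 := by simp [par]

/-- `par (n·z) = n·par z`. [cite: MochizukiFrdI2008, Prop. 1.6 p.28] -/
@[simp] theorem par_pow (z : M) (n : ℕ) : par (z ^ n) = n • par z := by
  simp [par, toAdd_pow, Nat.cast_mul, nsmul_eq_mul]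

/-- `par (ofAdd k) = k mod 2`. [cite: MochizukiFrdI2008, Prop. 1.6 p.28] -/
@[simp] theorem par_ofAdd (k : ℕ) : par (Multiplicative.ofAdd k) = (k : ZMod 2) := rfl

/-- The parity `ε(g)` of a base automorphism `g ∈ ℤ/2`. [cite: MochizukiFrdI2008, Prop. 1.6 p.28] -/
def eps (g : X) : ZMod 2 := Multiplicative.toAdd g

/-- `ε` is additive. [cite: MochizukiFrdI2008, Prop. 1.6 p.28] -/
@[simp] theorem eps_mul (g h : X) : eps (g * h) = eps g + eps h := toAdd_mul g h

/-- `ε(1) = 0`. [cite: MochizukiFrdI2008, Prop. 1.6 p.28] -/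
@[simp] theorem eps_one : eps 1 = 0 := rfl

/-- `ε(g⁻¹) = ε(g)` in `ℤ/2`. [cite: MochizukiFrdI2008, Prop. 1.6 p.28] -/
@[simp] theorem eps_inv (g : X) : eps g⁻¹ = eps g := by
  show -(Multiplicative.toAdd g) = Multiplicative.toAdd g
  exact ZMod.neg_eq_self_mod_two _

/-- `ε(g) = 0` iff `g = 1`. [cite: MochizukiFrdI2008, Prop. 1.6 p.28] -/
theorem eps_eq_zero_iff (g : X) : eps g = 0 ↔ g = 1 :=
  ⟨fun h => Multiplicative.toAdd.injective h, fun h => by subst h; rfl⟩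

/-- The non-trivial base automorphism `σ`. [cite: MochizukiFrdI2008, Prop. 1.6 p.28] -/
def σ : X := Multiplicative.ofAdd 1

/-- `ε(σ) = 1`. [cite: MochizukiFrdI2008, Prop. 1.6 p.28] -/
@[simp] theorem eps_σ : eps σ = 1 := rfl

/-- `σ ≠ 1`. [cite: MochizukiFrdI2008, Prop. 1.6 p.28] -/
theorem σ_ne_one : σ ≠ 1 := by decide

/-! ### The category -/

/-- The objects: `low` (the metrically trivial, non-`Aut`-ample one) and `top` (its isotropic hull).
[cite: MochizukiFrdI2008, Prop. 1.6 p.28] -/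
inductive Obj : Type
  | low
  | top
  deriving DecidableEq

/-- Admissibility of a triple `(g, z, n) ∈ End_{F_Φ}(∗)` as an arrow between two objects:
`low → low` iff `n = 1` and `z ≡ ε(g)`; `low → top`, `top → top` always; `top → low` never.
[cite: MochizukiFrdI2008, Prop. 1.6 p.28] -/
def Adm : Obj → Obj → (E ⟶ E) → Prop
  | .low, .low, φ => dg φ = 1 ∧ par (dv φ) = eps (bs φ)
  | .low, .top, _ => True
  | .top, .low, _ => False
  | .top, .top, _ => True

/-- Identities are admissible. [cite: MochizukiFrdI2008, Prop. 1.6 p.28] -/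
theorem adm_id (A : Obj) : Adm A A (𝟙 E) := by
  cases A
  · exact ⟨rfl, by rw [dv_id, bs_id, par_one, eps_one]⟩
  · trivial

/-- Admissible triples compose. [cite: MochizukiFrdI2008, Prop. 1.6 p.28] -/
theorem adm_comp {A B C : Obj} {φ ψ : E ⟶ E} (hφ : Adm A B φ) (hψ : Adm B C ψ) : Adm A C (φ ≫ ψ) := by
  cases A <;> cases B <;> cases C <;> simp only [Adm] at hφ hψ ⊢
  obtain ⟨hφ₁, hφ₂⟩ := hφ
  obtain ⟨hψ₁, hψ₂⟩ := hψ
  refine ⟨by rw [dg_comp, hφ₁, hψ₁, mul_one], ?_⟩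
  rw [dv_comp, bs_comp, hψ₁, PNat.one_coe, pow_one, par_mul, eps_mul, hφ₂, hψ₂]

/-- The two-level category `C`: arrows are admissible triples. [cite: MochizukiFrdI2008, Prop. 1.6 p.28] -/
instance instCategory : Category Obj where
  Hom A B := {φ : E ⟶ E // Adm A B φ}
  id A := ⟨𝟙 E, adm_id A⟩
  comp f g := ⟨f.1 ≫ g.1, adm_comp f.2 g.2⟩
  id_comp f := Subtype.ext (Category.id_comp f.1)
  comp_id f := Subtype.ext (Category.comp_id f.1)
  assoc f g h := Subtype.ext (Category.assoc f.1 g.1 h.1)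

/-- Extensionality: arrows of `C` are determined by their triples. [cite: MochizukiFrdI2008, Prop. 1.6 p.28] -/
@[ext] theorem hom_ext {A B : Obj} {f g : A ⟶ B} (h : f.1 = g.1) : f = g := Subtype.ext h

/-- The underlying triple of a composite. [cite: MochizukiFrdI2008, Prop. 1.6 p.28] -/
@[simp] theorem comp_val {A B C : Obj} (f : A ⟶ B) (g : B ⟶ C) : (f ≫ g).1 = f.1 ≫ g.1 := rfl

/-- The underlying triple of an identity. [cite: MochizukiFrdI2008, Prop. 1.6 p.28] -/
@[simp] theorem id_val (A : Obj) : (𝟙 A : A ⟶ A).1 = 𝟙 E := rfl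

/-- The pre-Frobenioid structure `C → F_Φ`: forget admissibility. [cite: MochizukiFrdI2008, Def. 1.1(iv) p.20] -/
def toElem : Obj ⥤ ElemFrobenioid Φ where
  obj _ := E
  map f := f.1

/-- `Base` through `toElem` is the base component. [cite: MochizukiFrdI2008, Def. 1.1(iv) p.20] -/
theorem base_def {A B : Obj} (f : A ⟶ B) : PreFrobenioid.Base toElem f = bs f.1 := rfl

/-- `Div` through `toElem` is the divisor component. [cite: MochizukiFrdI2008, Def. 1.1(iv) p.20] -/
theorem div_def {A B : Obj} (f : A ⟶ B) : PreFrobenioid.Div toElem f = dv f.1 := rfl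

/-- `deg_Fr` through `toElem` is the degree component. [cite: MochizukiFrdI2008, Def. 1.1(iv) p.20] -/
theorem degFr_def {A B : Obj} (f : A ⟶ B) : PreFrobenioid.degFr toElem f = dg f.1 := rfl

/-- The base object of every object is `∗`. [cite: MochizukiFrdI2008, Def. 1.1(iv) p.20] -/
theorem baseObj_def (A : Obj) : PreFrobenioid.baseObj toElem A = SingleObj.star X := rfl

/-- There is no arrow `top → low`. [cite: MochizukiFrdI2008, Prop. 1.6 p.28] -/
theorem no_top_low (f : Obj.top ⟶ Obj.low) : False := f.2

/-- Arrows `low → low` are linear. [cite: MochizukiFrdI2008, Prop. 1.6 p.28] -/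
theorem dg_low (f : Obj.low ⟶ Obj.low) : dg f.1 = 1 := f.2.1

/-- Arrows `low → low` satisfy the parity rule `Div ≡ ε(Base)`. [cite: MochizukiFrdI2008, Prop. 1.6 p.28] -/
theorem par_low (f : Obj.low ⟶ Obj.low) : par (dv f.1) = eps (bs f.1) := f.2.2

/-- The arrow `A → top` with a given triple. [cite: MochizukiFrdI2008, Prop. 1.6 p.28] -/
def toTop (A : Obj) (g : X) (z : M) (n : ℕ+) : A ⟶ Obj.top :=
  ⟨tr g z n, by cases A <;> trivial⟩

/-- The triple of `toTop`. [cite: MochizukiFrdI2008, Prop. 1.6 p.28] -/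
@[simp] theorem toTop_val (A : Obj) (g : X) (z : M) (n : ℕ+) : (toTop A g z n).1 = tr g z n := rfl

/-- The endomorphism `(g, z, 1)` of `low` for `z ≡ ε(g)`. [cite: MochizukiFrdI2008, Prop. 1.6 p.28] -/
def lowEnd (g : X) (z : M) (h : par z = eps g) : Obj.low ⟶ Obj.low :=
  ⟨tr g z 1, ⟨rfl, h⟩⟩

/-- The triple of `lowEnd`. [cite: MochizukiFrdI2008, Prop. 1.6 p.28] -/
@[simp] theorem lowEnd_val (g : X) (z : M) (h : par z = eps g) : (lowEnd g z h).1 = tr g z 1 := rfl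

/-- Every arrow `A → top` is a `toTop`. [cite: MochizukiFrdI2008, Prop. 1.6 p.28] -/
theorem eq_toTop {A : Obj} (f : A ⟶ Obj.top) : f = toTop A (bs f.1) (dv f.1) (dg f.1) :=
  hom_ext rfl

/-- Every arrow `low → low` is a `lowEnd`. [cite: MochizukiFrdI2008, Prop. 1.6 p.28] -/
theorem eq_lowEnd (f : Obj.low ⟶ Obj.low) : f = lowEnd (bs f.1) (dv f.1) (par_low f) :=
  hom_ext (E_ext rfl rfl (dg_low f))

/-! ### Isomorphisms -/

/-- In `ℤ_{≥0}` (multiplicative) a product is `1` only if the right factor is. [cite: MochizukiFrdI2008, §0 p.11] -/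
theorem eq_one_of_mul_eq_one_M {a b : M} (h : a * b = 1) : b = 1 := by
  have h' : Multiplicative.toAdd a + Multiplicative.toAdd b = 0 := by
    rw [← toAdd_mul, h, toAdd_one]
  exact Multiplicative.toAdd.injective (by rw [toAdd_one]; omega)

/-- An invertible arrow of `C` has `deg_Fr = 1` and `Div = 0`. [cite: MochizukiFrdI2008, Prop. 1.6 p.28] -/
theorem dg_dv_of_isIso {A B : Obj} (f : A ⟶ B) [IsIso f] : dg f.1 = 1 ∧ dv f.1 = 1 := by
  have h : f.1 ≫ (inv f).1 = 𝟙 E := by rw [← comp_val, IsIso.hom_inv_id, id_val]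
  have hd : dg f.1 * dg (inv f).1 = 1 := by rw [← dg_comp, h, dg_id]
  have hd1 : dg f.1 = 1 := pnat_eq_one_of_mul_eq_one hd
  refine ⟨hd1, ?_⟩
  have hz : dv (inv f).1 * dv f.1 ^ (dg (inv f).1 : ℕ) = 1 := by rw [← dv_comp, h, dv_id]
  have hdinv : dg (inv f).1 = 1 := by rw [hd1, one_mul] at hd; exact hd
  rw [hdinv, PNat.one_coe, pow_one] at hz
  exact eq_one_of_mul_eq_one_M hz

/-- The only automorphism of `low` is the identity. [cite: MochizukiFrdI2008, Prop. 1.6 p.28] -/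
theorem eq_id_of_isIso_low (f : Obj.low ⟶ Obj.low) [IsIso f] : f = 𝟙 Obj.low := by
  obtain ⟨hd, hz⟩ := dg_dv_of_isIso f
  have hb : bs f.1 = 1 := by
    have := par_low f
    rw [hz, par_one] at this
    exact (eps_eq_zero_iff _).mp this.symm
  exact hom_ext (E_ext hb hz hd)

/-- An automorphism of `low` has trivial base component. [cite: MochizukiFrdI2008, Prop. 1.6 p.28] -/
theorem bs_eq_one_of_isIso_low (f : Obj.low ⟶ Obj.low) [IsIso f] : bs f.1 = 1 := by
  have h : f.1 = (𝟙 Obj.low : Obj.low ⟶ Obj.low).1 := congrArg Subtype.val (eq_id_of_isIso_low f)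
  rw [h, id_val, bs_id]

/-- No arrow `low → top` is invertible. [cite: MochizukiFrdI2008, Prop. 1.6 p.28] -/
theorem not_isIso_low_top (f : Obj.low ⟶ Obj.top) : ¬ IsIso f := fun _ => no_top_low (inv f)

/-- The automorphism `(g, 0, 1)` of `top`. [cite: MochizukiFrdI2008, Prop. 1.6 p.28] -/
def topAut (g : X) : Obj.top ≅ Obj.top where
  hom := toTop Obj.top g 1 1
  inv := toTop Obj.top g⁻¹ 1 1
  hom_inv_id := hom_ext (E_ext (by simp) (by simp) (by simp))
  inv_hom_id := hom_ext (E_ext (by simp) (by simp) (by simp))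

/-- The triple of `topAut g`. [cite: MochizukiFrdI2008, Prop. 1.6 p.28] -/
@[simp] theorem topAut_hom_val (g : X) : (topAut g).hom.1 = tr g 1 1 := rfl

/-- An endomorphism of `top` with `deg_Fr = 1`, `Div = 0` is an isomorphism. [cite: MochizukiFrdI2008, Prop. 1.6 p.28] -/
theorem isIso_top_of (f : Obj.top ⟶ Obj.top) (hd : dg f.1 = 1) (hz : dv f.1 = 1) : IsIso f := by
  have : f = (topAut (bs f.1)).hom := hom_ext (E_ext rfl hz hd)
  rw [this]; infer_instance

/-- An arrow of `C` is invertible iff it is not of shape `low → top` and has `deg_Fr = 1`, `Div = 0`.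
[cite: MochizukiFrdI2008, Prop. 1.6 p.28] -/
theorem isIso_iff {A B : Obj} (f : A ⟶ B) :
    IsIso f ↔ A = B ∧ dg f.1 = 1 ∧ dv f.1 = 1 := by
  constructor
  · intro hf
    cases A <;> cases B
    · exact ⟨rfl, dg_dv_of_isIso f⟩
    · exact (not_isIso_low_top f hf).elim
    · exact (no_top_low f).elim
    · exact ⟨rfl, dg_dv_of_isIso f⟩
  · rintro ⟨rfl, hd, hz⟩
    cases A
    · have hb : bs f.1 = 1 := by
        have := par_low f
        rw [hz, par_one] at this
        exact (eps_eq_zero_iff _).mp this.symm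
      have : f = 𝟙 Obj.low := hom_ext (E_ext hb hz hd)
      rw [this]; infer_instance
    · exact isIso_top_of f hd hz

end TwoLevel

end Literature.AlgebraicGeometry.Frobenioids
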